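import Literature.NumberTheory.Sieve.LinearEquationsInPrimesNormalForm
import Literature.NumberTheory.Sieve.LinearEquationsInPrimesSingularSeries
import Literature.NumberTheory.Sieve.LinearEquationsInPrimesMultiplicativity
import HarnessLib

/-!
# Linear equations in primes: normal form extensions and the change of variables (Green–Tao 2010, §4)

Trunk T-SIEVE (`Literature/NumberTheory/Sieve`). B. Green, T. Tao, *Linear equations in primes*,
Ann. of Math. 171 (2010), §4: the "normal form reduction" of the Main Theorem replaces a system
`Ψ : ℤ^d → ℤ^t` of finite complexity by an *extension* (Def. 4.3) `Ψ'(n, m) = Ψ(n + ∑ₖ mₖ fₖ)`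
on `ℤ^{d'}` which is in `s`-normal form (Lemma 4.4, "Existence of normal forms"). This is the
linear-algebra input of the reduction `Literature.NumberTheory.Sieve.GreenTao2010_main_of_mainNormalForm`
(`LinearEquationsInPrimesNormalForm.lean`). Everything here is proved:

* `Literature.AffLinForm.extendAlong ψ f` — the form `(n, m) ↦ ψ(n + ∑ₗ mₗ fₗ)` on `ℤ^{d + k}` for
  vectors `f₁, …, f_k ∈ ℤ^d` (`extendAlong_eval`), and `Literature.NumberTheory.Sieve.IsExtensionOf` — Def. 4.3
  (`Ψ'(ℤ^{d'}) = Ψ(ℤ^d)` and `Ψ` is the restriction of `Ψ'` to `ℤ^d × {0}`), with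
  `Literature.NumberTheory.Sieve.isExtensionOf_extendAlong`;
* `Literature.NumberTheory.Sieve.isNondegenerateSystem_extendAlong` (the standing hypotheses survive),
  `Literature.NumberTheory.Sieve.natAbs_coeff_extendAlong_le` (coefficients stay `O_{d,L}(1)`: `≤ 2 d L²`);
* `Literature.NumberTheory.Sieve.localFactor_extendAlong` — `β'_q = β_q` for the extension ("translation-invariance of
  `ℤ_p`", proof of the Main Theorem assuming Thm. 4.5), via `localFactor_eq_sum_zmod`;
* **`Literature.NumberTheory.Sieve.GreenTao2010_existsNormalFormExtension`** — Lemma 4.4 for systems of finite complexity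
  (no two linear parts parallel), via the printed construction with the trivial cover by
  singletons (Lemma 1.6: such systems have `i`-complexity `≤ t - 2`): for each ordered pair
  `i ≠ j` a witness `f ∈ ℤ^d` with `ψ̇ⱼ(f) = 0 ≠ ψ̇ᵢ(f)` (from a non-zero `2 × 2` minor,
  `exists_minor_ne_zero`), giving an extension on `ℤ^{d + t²}` in `(t-2)`-normal form whose
  new vectors have entries `≤ 2L`;
* the change of variables of "Proof of the Main Theorem assuming Theorem 4.5":
  `Literature.NumberTheory.Sieve.extShiftInt` / `Literature.NumberTheory.Sieve.extShiftReal` (`(n, m) ↦ n + ∑ mₗ fₗ`), the body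
  `Literature.extBody f N K = K' = {(x, m) ∈ ℝ^d × [-N,N]^k : x + ∑ mₗ fₗ ∈ K}` (`convex_extBody`,
  `extBody_subset_realBox`: `K' ⊆ [-N',N']^{d+k}` for `N' ≥ (1 + kM)N`), and the counting
  identities `Literature.NumberTheory.Sieve.sum_extBody_eq`, `Literature.NumberTheory.Sieve.latticePointCount_extBody`,
  `Literature.NumberTheory.Sieve.vonMangoldtSum_extendAlong_extBody`:
  `∑_{K' ∩ ℤ^{d'}} F(n + ∑ mₗ fₗ) = (2N+1)^k ∑_{K ∩ ℤ^d} F`.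

## Design notes

* New variables are indexed by ordered pairs `(i, j) ∈ [t]²` (`Fin (t * t)` via
  `finProdFinEquiv`); the diagonal pairs carry the zero vector (a dummy variable no form uses —
  extensions may add unused parameters). The witness set of Def. 4.2 for the form `i` is
  `Jᵢ = {(i, j) : j ≠ i}`, of cardinality `t - 1 = (t - 2) + 1` (`t ≥ 2`; for `t = 1`, `J = ∅`).
* Lemma 4.4 is printed for "some finite complexity `s`" with an `s`-normal form conclusion; we
  prove the instance the Main-Theorem reduction for finite-complexity systems consumes
  (complexity `≤ t - 2` by Lemma 1.6, hence a `(t-2)`-normal form; recall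
  `IsNormalForm.mono`). "`d' = O(1)`" is `d' = d + t²`; "`‖Ψ'‖_N = O(1)`" follows from
  `natAbs_coeff_extendAlong_le` and the unchanged constant terms.

## References

* B. Green, T. Tao, *Linear equations in primes*, Ann. of Math. (2) 171 (2010), 1753–1850
  (arXiv:math/0606088): Lemma 1.6, Def. 4.2, Def. 4.3, Lemma 4.4 and its proof, "Proof of the
  Main Theorem assuming Theorem 4.5".
-/

noncomputable section

open Finset

namespace Literature.NumberTheory.Sieve

variable {d t k : ℕ}

namespace AffLinForm

/-- The extension of `ψ` along `f₁, …, f_k ∈ ℤ^d`: the affine-linear form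
`(n, m₁, …, m_k) ↦ ψ(n + m₁ f₁ + ⋯ + m_k f_k)` on `ℤ^{d+k}` (coefficients: `ψ̇(e_j)` on the old
variables, `ψ̇(f_l)` on the new ones; same constant). [cite: GreenTao2010, proof of Lemma 4.4] -/
def extendAlong (ψ : AffLinForm d) (f : Fin k → Fin d → ℤ) : AffLinForm (d + k) where
  coeff := Fin.append ψ.coeff fun l => ψ.linearPart (f l)
  const := ψ.const

/-- Old coefficients are unchanged. [folklore] -/
@[simp] theorem extendAlong_coeff_castAdd (ψ : AffLinForm d) (f : Fin k → Fin d → ℤ) (j : Fin d) :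
    (ψ.extendAlong f).coeff (Fin.castAdd k j) = ψ.coeff j := by
  simp [extendAlong]

/-- The coefficient of the new variable `m_l` is `ψ̇(f_l)`. [cite: GreenTao2010, proof of Lemma 4.4] -/
@[simp] theorem extendAlong_coeff_natAdd (ψ : AffLinForm d) (f : Fin k → Fin d → ℤ) (l : Fin k) :
    (ψ.extendAlong f).coeff (Fin.natAdd d l) = ψ.linearPart (f l) := by
  simp [extendAlong]

/-- The constant term is unchanged. [folklore] -/
@[simp] theorem extendAlong_const (ψ : AffLinForm d) (f : Fin k → Fin d → ℤ) :
    (ψ.extendAlong f).const = ψ.const := rfl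

/-- `ψ̇` is additive. [folklore] -/
theorem linearPart_add (ψ : AffLinForm d) (u v : Fin d → ℤ) :
    ψ.linearPart (u + v) = ψ.linearPart u + ψ.linearPart v := by
  simp [linearPart, mul_add, Finset.sum_add_distrib]

/-- `ψ̇` is homogeneous. [folklore] -/
theorem linearPart_smul (ψ : AffLinForm d) (c : ℤ) (u : Fin d → ℤ) :
    ψ.linearPart (c • u) = c * ψ.linearPart u := by
  simp [linearPart, Finset.mul_sum, mul_left_comm]

/-- `ψ̇` on a finite sum. [folklore] -/
theorem linearPart_sum {ι : Type*} (ψ : AffLinForm d) (s : Finset ι) (u : ι → Fin d → ℤ) :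
    ψ.linearPart (∑ i ∈ s, u i) = ∑ i ∈ s, ψ.linearPart (u i) := by
  classical
  induction s using Finset.induction_on with
  | empty => simp [linearPart]
  | insert a s ha ih => rw [Finset.sum_insert ha, Finset.sum_insert ha, linearPart_add, ih]

/-- `ψ(n + v) = ψ(n) + ψ̇(v)`. [cite: GreenTao2010, Def. 1.1] -/
theorem eval_add (ψ : AffLinForm d) (n v : Fin d → ℤ) :
    ψ.eval (n + v) = ψ.eval n + ψ.linearPart v := by
  simp only [eval, linearPart, Pi.add_apply, mul_add, Finset.sum_add_distrib]
  ring

/-- **The extension evaluates as printed**: `Ψ'(n, m) = Ψ(n + m₁ f₁ + ⋯ + m_k f_k)`, where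
`n` are the first `d` coordinates and `m` the last `k`. [cite: GreenTao2010, proof of Lemma 4.4] -/
theorem extendAlong_eval (ψ : AffLinForm d) (f : Fin k → Fin d → ℤ) (v : Fin (d + k) → ℤ) :
    (ψ.extendAlong f).eval v =
      ψ.eval ((fun j => v (Fin.castAdd k j)) + ∑ l, v (Fin.natAdd d l) • f l) := by
  rw [eval_add, linearPart_sum]
  simp only [linearPart_smul, eval, extendAlong, Fin.sum_univ_add, Fin.append_left,
    Fin.append_right]
  have : ∀ l : Fin k, ψ.linearPart (f l) * v (Fin.natAdd d l) = v (Fin.natAdd d l) * ψ.linearPart (f l) :=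
    fun l => mul_comm _ _
  simp only [this]
  ring

end AffLinForm

/-- **Extensions** (Green–Tao 2010, Def. 4.3, as printed: "An extension of this system is a
system `Ψ' : ℤ^{d'} → ℤ^t` with `d' ≥ d`, such that `Ψ'(ℤ^{d'}) = Ψ(ℤ^d)` and furthermore if we
identify `ℤ^d` with the subset `ℤ^d × {0}^{d'-d}` of `ℤ^{d'}` in the obvious manner, then `Ψ`
is the restriction of `Ψ'` to `ℤ^d`."), for `d' = d + k`. [cite: GreenTao2010, Def. 4.3] -/
def IsExtensionOf (Ψ' : Fin t → AffLinForm (d + k)) (Ψ : Fin t → AffLinForm d) : Prop :=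
  (Set.range fun v : Fin (d + k) → ℤ => fun i => (Ψ' i).eval v) =
      (Set.range fun n : Fin d → ℤ => fun i => (Ψ i).eval n) ∧
    ∀ (n : Fin d → ℤ) (i : Fin t), (Ψ' i).eval (Fin.append n 0) = (Ψ i).eval n

/-- The system extended along `f₁, …, f_k` is an extension in the sense of Def. 4.3.
[cite: GreenTao2010, Def. 4.3 and proof of Lemma 4.4] -/
theorem isExtensionOf_extendAlong (Ψ : Fin t → AffLinForm d) (f : Fin k → Fin d → ℤ) :
    IsExtensionOf (fun i => (Ψ i).extendAlong f) Ψ := by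
  constructor
  · ext y
    simp only [Set.mem_range]
    constructor
    · rintro ⟨v, rfl⟩
      exact ⟨_, funext fun i => (AffLinForm.extendAlong_eval (Ψ i) f v).symm⟩
    · rintro ⟨n, rfl⟩
      refine ⟨Fin.append n 0, funext fun i => ?_⟩
      rw [AffLinForm.extendAlong_eval]
      simp
  · intro n i
    rw [AffLinForm.extendAlong_eval]
    simp

/-- The standing hypotheses of Def. 1.1 pass to the extension (its restriction to
`ℤ^d × {0}` is `Ψ`). [cite: GreenTao2010, Def. 1.1] -/
theorem isNondegenerateSystem_extendAlong {Ψ : Fin t → AffLinForm d} (hΨ : IsNondegenerateSystem Ψ)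
    (f : Fin k → Fin d → ℤ) : IsNondegenerateSystem fun i => (Ψ i).extendAlong f := by
  refine ⟨fun i h => hΨ.1 i (funext fun j => ?_), fun i j hij a b hab => hΨ.2 i j hij a b fun n => ?_⟩
  · have := congr_fun h (Fin.castAdd k j)
    simpa using this
  · have := hab (Fin.append n 0)
    simpa [AffLinForm.extendAlong_eval] using this

/-- If `|ψ̇ᵢ(e_j)| ≤ L` and the new vectors have entries `|f_l(j)| ≤ M`, the extension has
coefficients `≤ max(L, d L M)`; we record the crude bound `≤ L + d L M` ("if the original
system had size `‖Ψ‖_N = O(1)`, then the same is true of the extended system").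
[cite: GreenTao2010, Lemma 4.4] -/
theorem natAbs_coeff_extendAlong_le {Ψ : Fin t → AffLinForm d} {L M : ℕ}
    (hL : ∀ i j, ((Ψ i).coeff j).natAbs ≤ L) {f : Fin k → Fin d → ℤ}
    (hM : ∀ l j, (f l j).natAbs ≤ M) (i : Fin t) (x : Fin (d + k)) :
    (((Ψ i).extendAlong f).coeff x).natAbs ≤ L + d * L * M := by
  refine Fin.addCases (fun j => ?_) (fun l => ?_) x
  · rw [AffLinForm.extendAlong_coeff_castAdd]
    exact (hL i j).trans (Nat.le_add_right _ _)
  · rw [AffLinForm.extendAlong_coeff_natAdd, AffLinForm.linearPart]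
    refine le_trans ?_ (Nat.le_add_left _ _)
    calc (∑ j, (Ψ i).coeff j * f l j).natAbs ≤ ∑ j, ((Ψ i).coeff j * f l j).natAbs :=
          Int.natAbs_sum_le _ _
      _ ≤ ∑ _j : Fin d, L * M := Finset.sum_le_sum fun j _ => by
          rw [Int.natAbs_mul]
          exact Nat.mul_le_mul (hL i j) (hM l j)
      _ = d * L * M := by
          rw [Finset.sum_const, Finset.card_univ, Fintype.card_fin, smul_eq_mul, mul_assoc]

/-! ### Lemma 4.4 -/

/-- The witness vector of the printed proof for a pair of non-parallel forms: with a non-zero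
minor `ψ̇ᵢ(e_a) ψ̇ⱼ(e_b) - ψ̇ᵢ(e_b) ψ̇ⱼ(e_a)`, the vector `f = ψ̇ⱼ(e_b) e_a - ψ̇ⱼ(e_a) e_b`
satisfies `ψ̇ⱼ(f) = 0` and `ψ̇ᵢ(f) ≠ 0`. [cite: GreenTao2010, proof of Lemma 4.4] -/
def minorWitness (φ : AffLinForm d) (a b : Fin d) : Fin d → ℤ :=
  Pi.single a (φ.coeff b) - Pi.single b (φ.coeff a)

/-- `ψ̇(c e_a) = c ψ̇(e_a)`. [folklore] -/
theorem AffLinForm.linearPart_single' (ψ : AffLinForm d) (a : Fin d) (c : ℤ) :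
    ψ.linearPart (Pi.single a c) = ψ.coeff a * c := by
  simp [AffLinForm.linearPart, Pi.single_apply]

/-- `ψ̇ᵢ(f) = ψ̇ᵢ(e_a) ψ̇ⱼ(e_b) - ψ̇ᵢ(e_b) ψ̇ⱼ(e_a)` for the witness of `(ψᵢ, ψⱼ)` at `(a, b)`.
[cite: GreenTao2010, proof of Lemma 4.4] -/
theorem linearPart_minorWitness (ψ φ : AffLinForm d) (a b : Fin d) :
    ψ.linearPart (minorWitness φ a b) = ψ.coeff a * φ.coeff b - ψ.coeff b * φ.coeff a := by
  rw [minorWitness, sub_eq_add_neg, AffLinForm.linearPart_add, ← neg_one_smul ℤ (Pi.single b _),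
    AffLinForm.linearPart_smul, AffLinForm.linearPart_single', AffLinForm.linearPart_single']
  ring

/-- The witness kills `φ̇`: `φ̇(f) = 0`. [cite: GreenTao2010, proof of Lemma 4.4] -/
theorem linearPart_minorWitness_self (φ : AffLinForm d) (a b : Fin d) :
    φ.linearPart (minorWitness φ a b) = 0 := by
  rw [linearPart_minorWitness]
  ring

/-- Entries of the witness are at most `2L` if `|φ̇(e_j)| ≤ L`. [folklore] -/
theorem natAbs_minorWitness_le (φ : AffLinForm d) {L : ℕ} (hL : ∀ j, (φ.coeff j).natAbs ≤ L)
    (a b x : Fin d) : (minorWitness φ a b x).natAbs ≤ 2 * L := by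
  rw [minorWitness, Pi.sub_apply]
  refine (Int.natAbs_sub_le _ _).trans ?_
  have h1 : ((Pi.single a (φ.coeff b) : Fin d → ℤ) x).natAbs ≤ L := by
    by_cases h : x = a
    · subst h; simpa using hL b
    · simp [h]
  have h2 : ((Pi.single b (φ.coeff a) : Fin d → ℤ) x).natAbs ≤ L := by
    by_cases h : x = b
    · subst h; simpa using hL a
    · simp [h]
  omega

/-- **Existence of normal forms** (Green–Tao 2010, Lemma 4.4, as printed: "Let `Ψ : ℤ^d → ℤ^t`
be a system of affine-linear forms of some finite complexity `s`. Then there exists an extension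
`Ψ' : ℤ^{d'} → ℤ^t` of `Ψ` which is in `s`-normal form, where `d' = O(1)`. Furthermore if the
original system `Ψ` had size `‖Ψ‖_N = O(1)`, then the same is true of the extended system
`Ψ'`."), in the instance for systems of finite complexity with the singleton cover of Lemma 1.6
(`s = t - 2`): there are vectors `f_l ∈ ℤ^d`, `l ∈ [t]²`, with entries `≤ 2L`, such that the
extension `Ψ'(n, m) = Ψ(n + ∑ₗ mₗ fₗ)` on `ℤ^{d + t²}` (an extension by
`isExtensionOf_extendAlong`, non-degenerate by `isNondegenerateSystem_extendAlong`, of size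
`O_{d,t}(L²)` by `natAbs_coeff_extendAlong_le`) is in `(t-2)`-normal form. Proof as printed:
for `i ≠ j` the witness `f_{(i,j)}` has `ψ̇ⱼ(f_{(i,j)}) = 0 ≠ ψ̇ᵢ(f_{(i,j)})`, and
`Jᵢ = {(i, j) : j ≠ i}`. [cite: GreenTao2010, Lemma 4.4] -/
theorem GreenTao2010_existsNormalFormExtension (Ψ : Fin t → AffLinForm d)
    (hΨ : IsNondegenerateSystem Ψ) (hfc : IsFiniteComplexitySystem Ψ) {L : ℕ}
    (hL : ∀ i j, ((Ψ i).coeff j).natAbs ≤ L) :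
    ∃ f : Fin (t * t) → Fin d → ℤ, (∀ l j, (f l j).natAbs ≤ 2 * L) ∧
      IsNormalForm (t - 2) fun i => (Ψ i).extendAlong f := by
  classical
  -- witnesses for ordered pairs `i ≠ j`
  have hmin : ∀ i j : Fin t, ∃ ab : Fin d × Fin d, i ≠ j →
      (Ψ i).coeff ab.1 * (Ψ j).coeff ab.2 - (Ψ i).coeff ab.2 * (Ψ j).coeff ab.1 ≠ 0 := by
    intro i j
    by_cases hij : i = j
    · by_cases hd : d = 0
      · subst hd
        exfalso
        exact hΨ.1 i (funext fun x => x.elim0)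
      · obtain ⟨x⟩ : Nonempty (Fin d) := ⟨⟨0, Nat.pos_of_ne_zero hd⟩⟩
        exact ⟨(x, x), fun h => absurd hij h⟩
    · obtain ⟨a, b, hab⟩ := exists_minor_ne_zero (hΨ.1 i) (hfc i j hij)
      exact ⟨(a, b), fun _ => hab⟩
  choose ab hab using hmin
  let e : Fin t × Fin t ≃ Fin (t * t) := finProdFinEquiv
  let f : Fin (t * t) → Fin d → ℤ := fun l =>
    if (e.symm l).1 = (e.symm l).2 then 0
    else minorWitness (Ψ (e.symm l).2) (ab (e.symm l).1 (e.symm l).2).1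
      (ab (e.symm l).1 (e.symm l).2).2
  have hf : ∀ i j : Fin t, i ≠ j → f (e (i, j)) = minorWitness (Ψ j) (ab i j).1 (ab i j).2 := by
    intro i j hij
    simp only [f, Equiv.symm_apply_apply, if_neg hij]
  refine ⟨f, fun l j => ?_, fun i => ?_⟩
  · simp only [f]
    split_ifs with h
    · simp
    · exact natAbs_minorWitness_le _ (hL _) _ _ _
  · -- the witness set `Jᵢ = {(i, j) : j ≠ i}`, as new variables of `ℤ^{d + t²}`
    refine ⟨(Finset.univ.filter fun j : Fin t => j ≠ i).image fun j => Fin.natAdd d (e (i, j)),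
      ?_, ?_, ?_⟩
    · refine (Finset.card_image_le).trans ?_
      rw [Finset.filter_ne' Finset.univ i, Finset.card_erase_of_mem (Finset.mem_univ i),
        Finset.card_univ, Fintype.card_fin]
      omega
    · rw [Finset.prod_image]
      · refine Finset.prod_ne_zero_iff.mpr fun j hj => ?_
        have hji : j ≠ i := (Finset.mem_filter.mp hj).2
        rw [AffLinForm.extendAlong_coeff_natAdd, hf i j hji.symm, linearPart_minorWitness]
        exact hab i j hji.symm
      · intro j _ j' _ h
        have h1 : e (i, j) = e (i, j') := (Fin.natAdd_inj d).mp h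
        simpa using e.injective h1
    · intro i' hi'
      have hmem : Fin.natAdd d (e (i, i')) ∈
          (Finset.univ.filter fun j : Fin t => j ≠ i).image fun j => Fin.natAdd d (e (i, j)) :=
        Finset.mem_image.mpr ⟨i', Finset.mem_filter.mpr ⟨Finset.mem_univ _, hi'⟩, rfl⟩
      refine Finset.prod_eq_zero hmem ?_
      rw [AffLinForm.extendAlong_coeff_natAdd, hf i i' (Ne.symm hi'), linearPart_minorWitness_self]

/-! ### The local factors of an extension -/

/-- Reduction mod `q` of the extension at `(a, m)`: `Ψ'(a, m) ≡ Ψ(a + ∑ₗ mₗ fₗ) (mod q)`.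
[cite: GreenTao2010, proof of Lemma 4.4] -/
theorem AffLinForm.modEval_extendAlong (ψ : AffLinForm d) (f : Fin k → Fin d → ℤ) (q : ℕ)
    (a : Fin d → ZMod q) (m : Fin k → ZMod q) :
    (ψ.extendAlong f).modEval q (Fin.append a m) =
      ψ.modEval q (a + fun j => ∑ l, m l * (f l j : ZMod q)) := by
  have hL : (ψ.extendAlong f).modEval q (Fin.append a m) =
      ∑ j, (ψ.coeff j : ZMod q) * a j +
        ∑ l, (∑ j, (ψ.coeff j : ZMod q) * (f l j : ZMod q)) * m l + (ψ.const : ZMod q) := by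
    simp only [AffLinForm.modEval, AffLinForm.extendAlong, Fin.sum_univ_add, Fin.append_left,
      Fin.append_right, AffLinForm.linearPart, Int.cast_sum, Int.cast_mul]
  have hR : ψ.modEval q (a + fun j => ∑ l, m l * (f l j : ZMod q)) =
      ∑ j, (ψ.coeff j : ZMod q) * a j +
        ∑ j, (ψ.coeff j : ZMod q) * ∑ l, m l * (f l j : ZMod q) + (ψ.const : ZMod q) := by
    simp only [AffLinForm.modEval, Pi.add_apply, mul_add, Finset.sum_add_distrib]
  rw [hL, hR]
  congr 2
  simp only [Finset.mul_sum, Finset.sum_mul]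
  rw [Finset.sum_comm]
  exact Finset.sum_congr rfl fun j _ => Finset.sum_congr rfl fun l _ => by ring

/-- **`β'_q = β_q`** for the extension along integer vectors (Green–Tao 2010, proof of the
Main Theorem assuming Thm. 4.5: "the local factors `β'_p` associated to the system `Ψ'` are
precisely the same as the local factors `β_p` associated to `Ψ`; this is ultimately due to the
translation-invariance of `ℤ_p`"), for every modulus `q ≥ 1`.
[cite: GreenTao2010, §4 (Proof of the Main Theorem assuming Theorem 4.5)] -/
theorem localFactor_extendAlong (Ψ : Fin t → AffLinForm d) (f : Fin k → Fin d → ℤ) (q : ℕ)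
    [NeZero q] : localFactor (fun i => (Ψ i).extendAlong f) q = localFactor Ψ q := by
  rw [localFactor_eq_sum_zmod, localFactor_eq_sum_zmod]
  set S := ∑ a : Fin d → ZMod q, ∏ i, localVonMangoldtZMod q ((Ψ i).modEval q a) with hS
  have hsum : ∑ v : Fin (d + k) → ZMod q,
      ∏ i, localVonMangoldtZMod q (((Ψ i).extendAlong f).modEval q v) =
        ∑ am : (Fin d → ZMod q) × (Fin k → ZMod q), ∏ i, localVonMangoldtZMod q
          ((Ψ i).modEval q (am.1 + fun j => ∑ l, am.2 l * (f l j : ZMod q))) := by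
    rw [← Equiv.sum_comp (Fin.appendEquiv d k)]
    refine Finset.sum_congr rfl fun am _ => Finset.prod_congr rfl fun i _ => ?_
    change localVonMangoldtZMod q (((Ψ i).extendAlong f).modEval q (Fin.append am.1 am.2)) = _
    rw [AffLinForm.modEval_extendAlong]
  have hinner : ∀ m : Fin k → ZMod q,
      ∑ a : Fin d → ZMod q, ∏ i, localVonMangoldtZMod q
          ((Ψ i).modEval q (a + fun j => ∑ l, m l * (f l j : ZMod q))) = S := fun m =>
    Fintype.sum_equiv (Equiv.addRight _) _ _ fun a => rfl
  rw [hsum, Fintype.sum_prod_type_right]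
  simp only [hinner, Finset.sum_const, Finset.card_univ, card_zmod_pow, nsmul_eq_mul,
    Nat.cast_pow]
  have hq : (q : ℝ) ≠ 0 := by exact_mod_cast NeZero.ne q
  rw [pow_add, mul_inv, mul_assoc, ← mul_assoc (((q : ℝ) ^ k)⁻¹), inv_mul_cancel₀ (pow_ne_zero k hq),
    one_mul]

/-! ### The change of variables of the normal form reduction -/

section ChangeOfVariables

variable {k : ℕ}

/-- The integer change of variables `(n, m) ↦ n + ∑ₗ mₗ fₗ` from `ℤ^{d+k}` to `ℤ^d`.
[cite: GreenTao2010, §4 (Proof of the Main Theorem assuming Theorem 4.5)] -/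
def extShiftInt (f : Fin k → Fin d → ℤ) (v : Fin (d + k) → ℤ) : Fin d → ℤ :=
  fun j => v (Fin.castAdd k j) + ∑ l, v (Fin.natAdd d l) * f l j

/-- The same change of variables on `ℝ^{d+k} → ℝ^d`. [cite: GreenTao2010, §4] -/
def extShiftReal (f : Fin k → Fin d → ℤ) (x : Fin (d + k) → ℝ) : Fin d → ℝ :=
  fun j => x (Fin.castAdd k j) + ∑ l, x (Fin.natAdd d l) * (f l j : ℝ)

/-- `Ψ'(n, m) = Ψ(n + ∑ mₗ fₗ)` in terms of `extShiftInt`. [cite: GreenTao2010, proof of Lemma 4.4] -/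
theorem AffLinForm.extendAlong_eval' (ψ : AffLinForm d) (f : Fin k → Fin d → ℤ)
    (v : Fin (d + k) → ℤ) : (ψ.extendAlong f).eval v = ψ.eval (extShiftInt f v) := by
  rw [AffLinForm.extendAlong_eval]
  congr 1
  funext j
  simp [extShiftInt, Finset.sum_apply]

/-- The real extension of `Ψ'` is `Ψ ∘ extShiftReal`. [cite: GreenTao2010, proof of Lemma 4.4] -/
theorem AffLinForm.extendAlong_realEval (ψ : AffLinForm d) (f : Fin k → Fin d → ℤ)
    (x : Fin (d + k) → ℝ) : (ψ.extendAlong f).realEval x = ψ.realEval (extShiftReal f x) := by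
  simp only [AffLinForm.realEval, AffLinForm.extendAlong, Fin.sum_univ_add, Fin.append_left,
    Fin.append_right, AffLinForm.linearPart, Int.cast_sum, Int.cast_mul, extShiftReal, mul_add,
    Finset.mul_sum, Finset.sum_add_distrib]
  have : ∑ l : Fin k, (∑ j : Fin d, (ψ.coeff j : ℝ) * (f l j : ℝ)) * x (Fin.natAdd d l) =
      ∑ j : Fin d, ∑ l : Fin k, (ψ.coeff j : ℝ) * (x (Fin.natAdd d l) * (f l j : ℝ)) := by
    simp only [Finset.sum_mul]
    rw [Finset.sum_comm]
    exact Finset.sum_congr rfl fun j _ => Finset.sum_congr rfl fun l _ => by ring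
  rw [this]

/-- The change of variables commutes with taking real points. [folklore] -/
theorem realPoint_extShiftInt (f : Fin k → Fin d → ℤ) (v : Fin (d + k) → ℤ) :
    realPoint (extShiftInt f v) = extShiftReal f (realPoint v) := by
  funext j
  simp [realPoint, extShiftInt, extShiftReal]

/-- `extShiftReal` is linear. [folklore] -/
theorem isLinearMap_extShiftReal (f : Fin k → Fin d → ℤ) : IsLinearMap ℝ (extShiftReal (d := d) f) := by
  constructor
  · intro x y
    funext j
    simp only [extShiftReal, Pi.add_apply, add_mul, Finset.sum_add_distrib]
    ring
  · intro c x
    funext j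
    simp only [extShiftReal, Pi.smul_apply, smul_eq_mul, Finset.mul_sum, mul_add]
    exact congrArg₂ (· + ·) rfl (Finset.sum_congr rfl fun l _ => by ring)

/-- The body `K' = {(x, m) ∈ ℝ^d × [-N,N]^k : x + ∑ mₗ fₗ ∈ K}` of the normal form reduction.
[cite: GreenTao2010, §4 (Proof of the Main Theorem assuming Theorem 4.5)] -/
def extBody (f : Fin k → Fin d → ℤ) (N : ℝ) (K : Set (Fin d → ℝ)) : Set (Fin (d + k) → ℝ) :=
  {x | (∀ l, |x (Fin.natAdd d l)| ≤ N) ∧ extShiftReal f x ∈ K}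

/-- `K'` is convex if `K` is. [cite: GreenTao2010, §4] -/
theorem convex_extBody (f : Fin k → Fin d → ℤ) (N : ℝ) {K : Set (Fin d → ℝ)} (hK : Convex ℝ K) :
    Convex ℝ (extBody f N K) := by
  have h1 : Convex ℝ {x : Fin (d + k) → ℝ | ∀ l, |x (Fin.natAdd d l)| ≤ N} := by
    have : {x : Fin (d + k) → ℝ | ∀ l, |x (Fin.natAdd d l)| ≤ N} =
        ⋂ l, {x | x (Fin.natAdd d l) ≤ N} ∩ {x | -N ≤ x (Fin.natAdd d l)} := by
      ext x
      simp [abs_le, and_comm]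
    rw [this]
    refine convex_iInter fun l => Convex.inter ?_ ?_
    · exact convex_halfSpace_le (IsLinearMap.mk (fun _ _ => rfl) fun _ _ => rfl) N
    · exact convex_halfSpace_ge (IsLinearMap.mk (fun _ _ => rfl) fun _ _ => rfl) (-N)
  exact h1.inter (hK.is_linear_preimage (isLinearMap_extShiftReal f))

/-- `K' ⊆ [-N', N']^{d+k}` for `N' ≥ (1 + k M) N` when `K ⊆ [-N,N]^d` and `|fₗ(j)| ≤ M`.
[cite: GreenTao2010, §4 ("This is contained in `[-N',N']^{d'}` for some `N' = O(N)`")] -/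
theorem extBody_subset_realBox (f : Fin k → Fin d → ℤ) {M : ℕ} (hf : ∀ l j, (f l j).natAbs ≤ M)
    {N N' : ℝ} (hN : 0 ≤ N) (hN' : (1 + k * M) * N ≤ N') {K : Set (Fin d → ℝ)}
    (hK : K ⊆ realBox d N) : extBody f N K ⊆ realBox (d + k) N' := by
  intro x hx
  obtain ⟨hm, hxK⟩ := hx
  have hr := hK hxK
  simp only [realBox, Set.mem_Icc, Pi.le_def] at hr
  have hkMN : 0 ≤ (k : ℝ) * M * N := by positivity
  have hNN' : N ≤ N' := by nlinarith
  have hbound : ∀ y : Fin (d + k), |x y| ≤ N' := by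
    refine Fin.addCases (fun j => ?_) (fun l => (hm l).trans hNN')
    have h1 : |extShiftReal f x j| ≤ N := abs_le.mpr ⟨hr.1 j, hr.2 j⟩
    have h2 : |∑ l, x (Fin.natAdd d l) * (f l j : ℝ)| ≤ k * M * N := by
      calc |∑ l, x (Fin.natAdd d l) * (f l j : ℝ)| ≤ ∑ l, |x (Fin.natAdd d l) * (f l j : ℝ)| :=
            Finset.abs_sum_le_sum_abs _ _
        _ ≤ ∑ _l : Fin k, N * M := Finset.sum_le_sum fun l _ => by
            rw [abs_mul]
            refine mul_le_mul (hm l) ?_ (abs_nonneg _) hN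
            rw [← Int.cast_abs]
            exact_mod_cast (Int.abs_eq_natAbs (f l j)).le.trans (by exact_mod_cast hf l j)
        _ = k * M * N := by
            rw [Finset.sum_const, Finset.card_univ, Fintype.card_fin, nsmul_eq_mul]; ring
    have h3 : x (Fin.castAdd k j) = extShiftReal f x j - ∑ l, x (Fin.natAdd d l) * (f l j : ℝ) := by
      simp [extShiftReal]
    rw [h3]
    calc |extShiftReal f x j - ∑ l, x (Fin.natAdd d l) * (f l j : ℝ)|
        ≤ |extShiftReal f x j| + |∑ l, x (Fin.natAdd d l) * (f l j : ℝ)| := abs_sub _ _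
      _ ≤ N + k * M * N := add_le_add h1 h2
      _ = (1 + k * M) * N := by ring
      _ ≤ N' := hN'
  simp only [realBox, Set.mem_Icc, Pi.le_def]
  exact ⟨fun y => (abs_le.mp (hbound y)).1, fun y => (abs_le.mp (hbound y)).2⟩

/-- On `K'`, `Ψ'` is as positive as `Ψ` is on `K`. [cite: GreenTao2010, §4] -/
theorem extendAlong_realEval_gt_of_mem_extBody {Ψ : Fin t → AffLinForm d} (f : Fin k → Fin d → ℤ)
    {N c : ℝ} {K : Set (Fin d → ℝ)} (hpos : ∀ x ∈ K, ∀ i, c < (Ψ i).realEval x)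
    {x : Fin (d + k) → ℝ} (hx : x ∈ extBody f N K) (i : Fin t) :
    c < ((Ψ i).extendAlong f).realEval x := by
  rw [AffLinForm.extendAlong_realEval]
  exact hpos _ hx.2 i

/-- The inverse change of variables `(m, r) ↦ (r - ∑ mₗ fₗ, m)`. [cite: GreenTao2010, §4] -/
def extUnshift (f : Fin k → Fin d → ℤ) (mr : (Fin k → ℤ) × (Fin d → ℤ)) : Fin (d + k) → ℤ :=
  Fin.append (fun j => mr.2 j - ∑ l, mr.1 l * f l j) mr.1

open Classical in
/-- **The change of variables `r := n + ∑ mₗ fₗ`** (Green–Tao 2010, proof of the Main Theorem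
assuming Thm. 4.5: "Making the change of variables `r := n + m_{d+1} f_{d+1} + ⋯ + m_{d'} f_{d'}`,
the left-hand side can be simplified to `|[-N,N]^{d'-d} ∩ ℤ^{d'-d}| ∑_{r ∈ K ∩ ℤ^d} (…)`"): for
`K ⊆ [-N,N]^d`, `|fₗ(j)| ≤ M` and `N' ≥ (1 + kM) N`,
`∑_{(n,m) ∈ K' ∩ ℤ^{d+k}} F(n + ∑ mₗ fₗ) = (2N+1)^k ∑_{r ∈ K ∩ ℤ^d} F(r)`.
[cite: GreenTao2010, §4 (Proof of the Main Theorem assuming Theorem 4.5)] -/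
theorem sum_extBody_eq {M : Type*} [AddCommMonoid M] (f : Fin k → Fin d → ℤ) {B : ℕ}
    (hf : ∀ l j, (f l j).natAbs ≤ B) {N N' : ℕ} (hN' : (1 + k * B) * N ≤ N')
    {K : Set (Fin d → ℝ)} (hK : K ⊆ realBox d N) (F : (Fin d → ℤ) → M) :
    ∑ v ∈ (latticeBox (d + k) N').filter (fun v => realPoint v ∈ extBody f N K),
        F (extShiftInt f v) =
      (2 * N + 1) ^ k • ∑ n ∈ (latticeBox d N).filter (fun n => realPoint n ∈ K), F n := by
  classical
  -- `#([-N,N]^k ∩ ℤ^k) = (2N+1)^k`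
  have hcard : #(latticeBox k N) = (2 * N + 1) ^ k := by
    have h1 : ((N : ℤ) + 1 - -(N : ℤ)) = ((2 * N + 1 : ℕ) : ℤ) := by push_cast; ring
    simp only [latticeBox, Fintype.card_piFinset, Int.card_Icc, Finset.prod_const,
      Finset.card_univ, Fintype.card_fin, h1, Int.toNat_natCast]
  have hBf : ∀ l j, |f l j| ≤ (B : ℤ) := fun l j => by
    rw [Int.abs_eq_natAbs]; exact_mod_cast hf l j
  have hNN' : N ≤ N' := le_trans (by nlinarith [Nat.zero_le (k * B * N)]) hN'
  -- the bijection `(n, m) ↦ (m, n + ∑ mₗ fₗ)` onto `[-N,N]^k × (K ∩ ℤ^d)`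
  have key : ∑ v ∈ (latticeBox (d + k) N').filter (fun v => realPoint v ∈ extBody f N K),
      F (extShiftInt f v) =
        ∑ mr ∈ latticeBox k N ×ˢ (latticeBox d N).filter (fun n => realPoint n ∈ K), F mr.2 := by
    refine Finset.sum_nbij' (fun v => (fun l => v (Fin.natAdd d l), extShiftInt f v))
      (extUnshift f) ?_ ?_ ?_ ?_ (fun v _ => rfl)
    · -- into the target
      intro v hv
      obtain ⟨-, hm, hK'⟩ := Finset.mem_filter.mp hv
      have hr : realPoint (extShiftInt f v) ∈ K := by rw [realPoint_extShiftInt]; exact hK'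
      refine Finset.mem_product.mpr ⟨Fintype.mem_piFinset.mpr fun l => Finset.mem_Icc.mpr ?_,
        Finset.mem_filter.mpr ⟨?_, hr⟩⟩
      · have h1 : |(v (Fin.natAdd d l) : ℝ)| ≤ (N : ℝ) := hm l
        rw [← Int.cast_abs] at h1
        exact abs_le.mp (by exact_mod_cast h1)
      · have := hK hr
        simp only [realBox, Set.mem_Icc, Pi.le_def, realPoint] at this
        refine Fintype.mem_piFinset.mpr fun j => Finset.mem_Icc.mpr ⟨?_, ?_⟩
        · exact_mod_cast this.1 j
        · exact_mod_cast this.2 j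
    · -- the inverse maps into the source
      intro mr hmr
      obtain ⟨hm, hr⟩ := Finset.mem_product.mp hmr
      obtain ⟨hrbox, hrK⟩ := Finset.mem_filter.mp hr
      have hml : ∀ l, -(N : ℤ) ≤ mr.1 l ∧ mr.1 l ≤ N := fun l =>
        Finset.mem_Icc.mp (Fintype.mem_piFinset.mp hm l)
      have hrj : ∀ j, -(N : ℤ) ≤ mr.2 j ∧ mr.2 j ≤ N := fun j =>
        Finset.mem_Icc.mp (Fintype.mem_piFinset.mp hrbox j)
      have hshift : extShiftInt f (extUnshift f mr) = mr.2 := by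
        funext j
        simp [extShiftInt, extUnshift]
      refine Finset.mem_filter.mpr ⟨Fintype.mem_piFinset.mpr fun y => ?_, fun l => ?_, ?_⟩
      · refine Fin.addCases (fun j => ?_) (fun l => ?_) y
        · simp only [extUnshift, Fin.append_left]
          have hsum : |∑ l, mr.1 l * f l j| ≤ k * B * N := by
            calc |∑ l, mr.1 l * f l j| ≤ ∑ l, |mr.1 l * f l j| := Finset.abs_sum_le_sum_abs _ _
              _ ≤ ∑ _l : Fin k, (N : ℤ) * B := Finset.sum_le_sum fun l _ => by
                  rw [abs_mul]
                  exact mul_le_mul (abs_le.mpr (hml l)) (hBf l j) (abs_nonneg _) (by positivity)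
              _ = k * B * N := by
                  rw [Finset.sum_const, Finset.card_univ, Fintype.card_fin, nsmul_eq_mul]; ring
          have h1 : |mr.2 j - ∑ l, mr.1 l * f l j| ≤ N' := by
            calc |mr.2 j - ∑ l, mr.1 l * f l j| ≤ |mr.2 j| + |∑ l, mr.1 l * f l j| := abs_sub _ _
              _ ≤ N + k * B * N := add_le_add (abs_le.mpr (hrj j)) hsum
              _ = (1 + k * B) * N := by ring
              _ ≤ N' := by exact_mod_cast hN'
          exact Finset.mem_Icc.mpr (abs_le.mp h1)
        · simp only [extUnshift, Fin.append_right]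
          have : (N : ℤ) ≤ N' := by exact_mod_cast hNN'
          exact Finset.mem_Icc.mpr ⟨by linarith [(hml l).1], by linarith [(hml l).2]⟩
      · show |((extUnshift f mr (Fin.natAdd d l) : ℤ) : ℝ)| ≤ N
        simp only [extUnshift, Fin.append_right]
        rw [← Int.cast_abs]
        exact_mod_cast abs_le.mpr (hml l)
      · show extShiftReal f (realPoint (extUnshift f mr)) ∈ K
        rw [← realPoint_extShiftInt, hshift]
        exact hrK
    · -- left inverse
      intro v _
      funext y
      refine Fin.addCases (fun j => ?_) (fun l => ?_) y
      · simp [extUnshift, extShiftInt]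
      · simp [extUnshift]
    · -- right inverse
      intro mr _
      refine Prod.ext (funext fun l => ?_) (funext fun j => ?_)
      · simp [extUnshift]
      · simp [extShiftInt, extUnshift]
  rw [key, Finset.sum_product]
  dsimp only
  rw [Finset.sum_const, hcard]

/-- In particular `#(K' ∩ ℤ^{d+k}) = (2N+1)^k #(K ∩ ℤ^d)`. [cite: GreenTao2010, §4] -/
theorem latticePointCount_extBody (f : Fin k → Fin d → ℤ) {B : ℕ} (hf : ∀ l j, (f l j).natAbs ≤ B)
    {N N' : ℕ} (hN' : (1 + k * B) * N ≤ N') {K : Set (Fin d → ℝ)} (hK : K ⊆ realBox d N) :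
    latticePointCount (extBody f N K) N' = (2 * N + 1) ^ k * latticePointCount K N := by
  classical
  unfold latticePointCount
  rw [Finset.card_eq_sum_ones, Finset.card_eq_sum_ones]
  have := sum_extBody_eq f hf hN' hK (fun _ => (1 : ℕ))
  simpa using this

/-- And `∑_{(n,m) ∈ K' ∩ ℤ^{d'}} ∏ᵢ Λ(ψ'ᵢ(n, m)) = (2N+1)^k ∑_{r ∈ K ∩ ℤ^d} ∏ᵢ Λ(ψᵢ(r))`.
[cite: GreenTao2010, §4 (Proof of the Main Theorem assuming Theorem 4.5)] -/
theorem vonMangoldtSum_extendAlong_extBody (Ψ : Fin t → AffLinForm d) (f : Fin k → Fin d → ℤ)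
    {B : ℕ} (hf : ∀ l j, (f l j).natAbs ≤ B) {N N' : ℕ} (hN' : (1 + k * B) * N ≤ N')
    {K : Set (Fin d → ℝ)} (hK : K ⊆ realBox d N) :
    vonMangoldtSum (fun i => (Ψ i).extendAlong f) (extBody f N K) N' =
      (2 * N + 1) ^ k * vonMangoldtSum Ψ K N := by
  classical
  unfold vonMangoldtSum
  simp only [AffLinForm.extendAlong_eval']
  rw [sum_extBody_eq f hf hN' hK (fun n => ∏ i, intVonMangoldt ((Ψ i).eval n)), nsmul_eq_mul]
  push_cast
  ring

end ChangeOfVariables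

end Literature.NumberTheory.Sieve
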